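import Mathlib
import HarnessLib
import Literature.Computability.Complexity.CircuitLowerBounds
import Literature.Computability.Complexity.CircuitSemantics
import Literature.Computability.AlgebraicComplexity.CircuitArithmetization

/-!
# Route Circuit, crux CircuitSuperlinear (stmt-PneNP-0036), line Sketch: stub stub_kwTransfer — Karchmer–Wigderson linear representations of `B₂`-circuits

M. Karchmer, A. Wigderson, *Characterizing non-deterministic circuit size*, STOC 1993, Def. 9 and
Thm. 7 with Thm. 1 (deterministic case, per circuit): the function computed by a circuit `C` over
the full binary basis `B₂` on `n` inputs *affords a linear representation* over `GF(2)` of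
dimension `2t + 1`, `t = 2 · C.size + 1`: there are a `GF(2)`-linear map
`P : GF(2)ⁿ → GF(2) × (GF(2)²)ᵗ` and a subspace `Q` of the target such that for every Boolean
input `z`,

  `C(z) = 0 ⟺ ∃ q ∈ Q, σ_t (P ẑ + q)`, `σ_t(y) ⟺ y.1 = 1 ∧ ∀ j, y.2 j ≠ (0, 0)`,

where `ẑ = boolOfZMod2 z` is the `0/1`-embedding (`Literature.Computability.Complexity.boolOfZMod2`).

## The construction (a direct straight-line-program proof, no covering numbers)

Work in the witness space `M = GF(2)ⁿ × (GF(2) × GF(2)ˢ)` (`s = C.size`): the input coordinates,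
one coordinate `ε` (forced to be `1` by `σ_t`) and one coordinate `α_m` per gate `m`. Over
`GF(2)` the truth table of a gate of fan-in `≤ 2` is `T(U, V) = A·U·V + B·U + C·V + D`, and
`A·U·V + B·U + C·V + D = p·q + r` with the AFFINE forms `p = A (U + C)`, `q = A (V + B)`,
`r = (1 + A)(B U + C V) + D + A B C` (`toK_table_eq`). For `p q r a ∈ GF(2)` one has
`(p, a + r + 1) ≠ 0 ∧ (p + 1, a + r + q + 1) ≠ 0 ⟺ a = p q + r` (`pair_ne_zero_iff`), so two pairs
of linear forms per gate (constants ride on `ε`) express the gate equation `α_m = T(args)`, and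
one pair `(o + ε, o + ε)` expresses "output wire `o = 0`". At a point with `ε = 1` all `2s + 1`
pairs are nonzero iff `α` is the true transcript of `C` on `z` (uniqueness of transcripts,
`eq_transcript_of_gate_equations` of `CircuitSemantics.lean`, through the Boolean transcript
interface `bwval`/`bargval`/`btable_bargval` of `CircuitArithmetization.lean`) and `C(z) = 0`.
With `L : M → GF(2) × (GF(2)²)^{2s+1}` the resulting linear map, `P := L ∘ inl` and
`Q := range (L ∘ inr)` represent `C`.

Only `stub_kwTransfer` is consumed by the line's skeleton; everything else is a helper. Not here:
the converse of KW93 Thm. 7 (representations ⇒ nondeterministic circuits) and the `ρ^{∨}_A` variants.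
-/

set_option linter.dupNamespace false -- `Summit.PneNP.PneNP.…`: summit = sub-problem name (D-0017)

namespace Summit.PneNP.PneNP.Cruxes.CircuitSuperlinear.Sketch

open Filter Literature.Computability.Complexity Literature.Computability.Complexity.Nondeterministic
open Literature.Computability.AlgebraicComplexity.CircuitArith (toK toK_true toK_false bwval
  bwval_eq_wireVal bargval btable_bargval)

/-! ### `GF(2)` gadgets -/

/-- `boolOfZMod2` is the coordinatewise `0/1`-embedding `toK`. [folklore] -/
theorem boolOfZMod2_apply {n : ℕ} (z : Fin n → Bool) (i : Fin n) :
    boolOfZMod2 z i = toK (ZMod 2) (z i) := by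
  show finTwoEquiv.symm (z i) = _
  cases z i <;> rfl

/-- `toK` is injective on `Bool` (over `GF(2)`). [folklore] -/
theorem toK_inj_iff (a b : Bool) : toK (ZMod 2) a = toK (ZMod 2) b ↔ a = b := by
  revert a b
  decide

/-- Every element of `GF(2)` is `toK` of a Boolean. [folklore] -/
theorem eq_toK_decide (a : ZMod 2) : a = toK (ZMod 2) (decide (a = 1)) := by
  revert a
  decide

/-- The coefficient `A = T(0,0) + T(1,0) + T(0,1) + T(1,1)` of `U·V` in the multilinear form of a
binary truth table over `GF(2)`. [folklore] -/
def kwA (T : Bool → Bool → Bool) : ZMod 2 :=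
  toK (ZMod 2) (T false false) + toK (ZMod 2) (T true false) + toK (ZMod 2) (T false true) +
    toK (ZMod 2) (T true true)

/-- The coefficient `B = T(0,0) + T(1,0)` of `U` in the multilinear form of a binary truth table
over `GF(2)`. [folklore] -/
def kwB (T : Bool → Bool → Bool) : ZMod 2 := toK (ZMod 2) (T false false) + toK (ZMod 2) (T true false)

/-- The coefficient `C = T(0,0) + T(0,1)` of `V` in the multilinear form of a binary truth table
over `GF(2)`. [folklore] -/
def kwC (T : Bool → Bool → Bool) : ZMod 2 := toK (ZMod 2) (T false false) + toK (ZMod 2) (T false true)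

/-- The constant coefficient `D = T(0,0)` of the multilinear form of a binary truth table over
`GF(2)`. [folklore] -/
def kwD (T : Bool → Bool → Bool) : ZMod 2 := toK (ZMod 2) (T false false)

/-- **Gate algebra over `GF(2)`**: `T(U, V) = A U V + B U + C V + D = p q + r` with
`p = A (U + C)`, `q = A (V + B)`, `r = (1 + A)(B U + C V) + (D + A B C)` (a product of two affine
forms plus an affine form). [folklore] -/
theorem toK_table_eq (T : Bool → Bool → Bool) (b0 b1 : Bool) :
    toK (ZMod 2) (T b0 b1) =
      kwA T * (toK (ZMod 2) b0 + kwC T) * (kwA T * (toK (ZMod 2) b1 + kwB T)) +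
        ((1 + kwA T) * (kwB T * toK (ZMod 2) b0 + kwC T * toK (ZMod 2) b1) +
          (kwD T + kwA T * kwB T * kwC T)) := by
  unfold kwA kwB kwC kwD
  cases b0 <;> cases b1 <;> cases T false false <;> cases T true false <;> cases T false true <;>
    cases T true true <;> decide

/-- **Pair encoding of a gate equation**: for `p q r a ∈ GF(2)`,
`(p, a + r + 1) ≠ 0 ∧ (p + 1, a + r + q + 1) ≠ 0 ⟺ a = p q + r`. [folklore] -/
theorem pair_ne_zero_iff (p q r a : ZMod 2) :
    ((p, a + r + 1) ≠ (0 : ZMod 2 × ZMod 2) ∧ (p + 1, a + r + q + 1) ≠ (0 : ZMod 2 × ZMod 2)) ↔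
      a = p * q + r := by
  revert p q r a
  decide

/-- **Pair encoding of "value `0`"**: `(o + 1, o + 1) ≠ 0 ⟺ o = 0` in `GF(2)²`. [folklore] -/
theorem out_pair_ne_zero_iff (o : ZMod 2) : (o + 1, o + 1) ≠ (0 : ZMod 2 × ZMod 2) ↔ o = 0 := by
  revert o
  decide

/-! ### The witness space and its linear forms -/

/-- The witness space `M = GF(2)ⁿ × (GF(2) × GF(2)ˢ)`: input coordinates, the coordinate `ε`,
one coordinate per gate. [folklore] -/
abbrev KwSpace (n s : ℕ) : Type := (Fin n → ZMod 2) × (ZMod 2 × (Fin s → ZMod 2))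

/-- Linear forms on the witness space. [folklore] -/
abbrev KwForm (n s : ℕ) : Type := KwSpace n s →ₗ[ZMod 2] ZMod 2

/-- The coordinate form `ε`. [folklore] -/
def epsF {n s : ℕ} : KwForm n s where
  toFun v := v.2.1
  map_add' _ _ := rfl
  map_smul' _ _ := rfl

/-- The coordinate form of input `i`. [folklore] -/
def inF {n s : ℕ} (i : Fin n) : KwForm n s where
  toFun v := v.1 i
  map_add' _ _ := rfl
  map_smul' _ _ := rfl

/-- The coordinate form `α_j` of gate `j`. [folklore] -/
def gateF {n s : ℕ} (j : Fin s) : KwForm n s where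
  toFun v := v.2.2 j
  map_add' _ _ := rfl
  map_smul' _ _ := rfl

/-- The form of a wire: an input coordinate, a gate coordinate, or `0` for a dangling
back-reference (mirrors `CircuitArith.bwval`). [folklore] -/
def wireF {n s : ℕ} : Fin n ⊕ ℕ → KwForm n s
  | .inl i => inF i
  | .inr m => if h : m < s then gateF ⟨m, h⟩ else 0

/-- The form of argument `a` of a gate (`0` for a missing argument; mirrors
`CircuitArith.bargval`). [folklore] -/
def argF {n s : ℕ} (g : Gate (Fin n)) (a : ℕ) : KwForm n s :=
  if h : a < g.arity then wireF (g.args ⟨a, h⟩) else 0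

/-- The affine factor `p = A (U + C)` of a gate, as a linear form (the constant rides on `ε`). [folklore] -/
def pF {n s : ℕ} (g : Gate (Fin n)) : KwForm n s :=
  kwA (btable g) • ((argF g 0 : KwForm n s) + kwC (btable g) • (epsF : KwForm n s))

/-- The affine factor `q = A (V + B)` of a gate, as a linear form. [folklore] -/
def qF {n s : ℕ} (g : Gate (Fin n)) : KwForm n s :=
  kwA (btable g) • ((argF g 1 : KwForm n s) + kwB (btable g) • (epsF : KwForm n s))

/-- The affine remainder `r = (1 + A)(B U + C V) + (D + A B C)` of a gate, as a linear form. [folklore] -/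
def rF {n s : ℕ} (g : Gate (Fin n)) : KwForm n s :=
  (1 + kwA (btable g)) • (kwB (btable g) • (argF g 0 : KwForm n s) + kwC (btable g) • (argF g 1 : KwForm n s)) +
    (kwD (btable g) + kwA (btable g) * kwB (btable g) * kwC (btable g)) • (epsF : KwForm n s)

/-- The two pairs of forms of a gate `g` with value coordinate `α_m`:
even `(p, α_m + r + ε)`, odd `(p + ε, α_m + r + q + ε)`. [folklore] -/
def gateRowOf {n s : ℕ} (g : Gate (Fin n)) (m : Fin s) (odd : Bool) : KwForm n s × KwForm n s :=
  bif odd then (pF g + epsF, gateF m + rF g + qF g + epsF) else (pF g, gateF m + rF g + epsF)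

/-! ### Values at Boolean points -/

/-- The Boolean point `(ẑ, 1, ŷ)` of the witness space. [folklore] -/
def bv {n s : ℕ} (z : Fin n → Bool) (y : Fin s → Bool) : KwSpace n s :=
  (boolOfZMod2 z, (1, fun j => toK (ZMod 2) (y j)))

/-- `ε = 1` at a Boolean point. [folklore] -/
theorem epsF_bv {n s : ℕ} (z : Fin n → Bool) (y : Fin s → Bool) : (epsF : KwForm n s) (bv z y) = 1 := rfl

/-- `α_j = ŷ_j` at a Boolean point. [folklore] -/
theorem gateF_bv {n s : ℕ} (z : Fin n → Bool) (y : Fin s → Bool) (j : Fin s) :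
    (gateF j : KwForm n s) (bv z y) = toK (ZMod 2) (y j) := rfl

/-- A wire form at a Boolean point is the Boolean wire value `bwval`. [folklore] -/
theorem wireF_bv {n s : ℕ} (z : Fin n → Bool) (y : Fin s → Bool) (w : Fin n ⊕ ℕ) :
    (wireF w : KwForm n s) (bv z y) = toK (ZMod 2) (bwval z y w) := by
  cases w with
  | inl i => exact boolOfZMod2_apply z i
  | inr m =>
    by_cases h : m < s
    · simp only [wireF, bwval, h, ↓reduceDIte]
      rfl
    · simp only [wireF, bwval, h, ↓reduceDIte, LinearMap.zero_apply, toK_false]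

/-- An argument form at a Boolean point is the Boolean argument value `bargval`. [folklore] -/
theorem argF_bv {n s : ℕ} (z : Fin n → Bool) (y : Fin s → Bool) (g : Gate (Fin n)) (a : ℕ) :
    (argF g a : KwForm n s) (bv z y) = toK (ZMod 2) (bargval z y g a) := by
  by_cases h : a < g.arity
  · simp only [argF, bargval, h, ↓reduceDIte]
    exact wireF_bv z y _
  · simp only [argF, bargval, h, ↓reduceDIte, LinearMap.zero_apply, toK_false]

/-- The value of `p` at a Boolean point. [folklore] -/
theorem pF_bv {n s : ℕ} (z : Fin n → Bool) (y : Fin s → Bool) (g : Gate (Fin n)) :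
    (pF g : KwForm n s) (bv z y) =
      kwA (btable g) * (toK (ZMod 2) (bargval z y g 0) + kwC (btable g)) := by
  simp only [pF, LinearMap.smul_apply, LinearMap.add_apply, argF_bv, epsF_bv, smul_eq_mul, mul_one]

/-- The value of `q` at a Boolean point. [folklore] -/
theorem qF_bv {n s : ℕ} (z : Fin n → Bool) (y : Fin s → Bool) (g : Gate (Fin n)) :
    (qF g : KwForm n s) (bv z y) =
      kwA (btable g) * (toK (ZMod 2) (bargval z y g 1) + kwB (btable g)) := by
  simp only [qF, LinearMap.smul_apply, LinearMap.add_apply, argF_bv, epsF_bv, smul_eq_mul, mul_one]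

/-- The value of `r` at a Boolean point. [folklore] -/
theorem rF_bv {n s : ℕ} (z : Fin n → Bool) (y : Fin s → Bool) (g : Gate (Fin n)) :
    (rF g : KwForm n s) (bv z y) =
      (1 + kwA (btable g)) *
          (kwB (btable g) * toK (ZMod 2) (bargval z y g 0) + kwC (btable g) * toK (ZMod 2) (bargval z y g 1)) +
        (kwD (btable g) + kwA (btable g) * kwB (btable g) * kwC (btable g)) := by
  simp only [rF, LinearMap.smul_apply, LinearMap.add_apply, argF_bv, epsF_bv, smul_eq_mul, mul_one]

/-- **The two pairs of a gate are nonzero iff the gate equation holds** (fan-in `≤ 2`):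
at the Boolean point `(ẑ, 1, ŷ)`, both pairs of `gateRowOf g m` are `≠ (0,0)` iff
`ŷ_m = g(args)`. [folklore] -/
theorem gatePairs_iff {n s : ℕ} (g : Gate (Fin n)) (hg : g.arity ≤ 2) (z : Fin n → Bool)
    (y : Fin s → Bool) (m : Fin s) :
    (((pF g : KwForm n s) (bv z y), (gateF m + rF g + epsF : KwForm n s) (bv z y)) ≠ (0 : ZMod 2 × ZMod 2) ∧
      ((pF g + epsF : KwForm n s) (bv z y), (gateF m + rF g + qF g + epsF : KwForm n s) (bv z y)) ≠
        (0 : ZMod 2 × ZMod 2)) ↔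
    y m = g.op fun a => bwval z y (g.args a) := by
  rw [← btable_bargval z y g hg, ← toK_inj_iff, toK_table_eq (btable g)]
  simp only [LinearMap.add_apply, pF_bv, qF_bv, rF_bv, gateF_bv, epsF_bv]
  exact pair_ne_zero_iff _ _ _ _

/-- **The output pair is nonzero iff the wire is `0`**: at `(ẑ, 1, ŷ)`, `(o + ε, o + ε) ≠ (0,0)`
iff the Boolean value of the wire is `false`. [folklore] -/
theorem outPair_iff {n s : ℕ} (z : Fin n → Bool) (y : Fin s → Bool) (w : Fin n ⊕ ℕ) :
    ((wireF w + epsF : KwForm n s) (bv z y), (wireF w + epsF : KwForm n s) (bv z y)) ≠ (0 : ZMod 2 × ZMod 2) ↔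
      bwval z y w = false := by
  simp only [LinearMap.add_apply, wireF_bv, epsF_bv]
  rw [out_pair_ne_zero_iff]
  cases bwval z y w <;> decide

/-! ### The linear map of a circuit -/

variable {n : ℕ} (C : Circuit (Fin n))

/-- The two pairs of gate `m` of `C`. [folklore] -/
def gateRow (m : Fin C.size) (odd : Bool) : KwForm n C.size × KwForm n C.size :=
  gateRowOf (C.gates[m.val]'m.isLt) m odd

/-- The output pair `(o + ε, o + ε)` of `C`. [folklore] -/
def outRow : KwForm n C.size × KwForm n C.size :=
  (wireF C.output + epsF, wireF C.output + epsF)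

/-- Row `j < 2 s + 1` of the representation: rows `2m`, `2m+1` are the pairs of gate `m`, row
`2s` is the output pair. [folklore] -/
def kwRow (j : ℕ) : KwForm n C.size × KwForm n C.size :=
  if h : j / 2 < C.size then gateRow C ⟨j / 2, h⟩ (decide (j % 2 = 1)) else outRow C

/-- **The Karchmer–Wigderson linear map** `L : M → GF(2) × (GF(2)²)^{2s+1}` of `C`:
first coordinate `ε`, then the `2s + 1` pairs. [folklore] -/
def kwL : KwSpace n C.size →ₗ[ZMod 2] ZMod 2 × (Fin (2 * C.size + 1) → ZMod 2 × ZMod 2) :=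
  LinearMap.prod epsF (LinearMap.pi fun j => LinearMap.prod (kwRow C j.val).1 (kwRow C j.val).2)

/-- Coordinate `j` of the second component of `kwL`. [folklore] -/
theorem kwL_snd_mk (v : KwSpace n C.size) (k : ℕ) (hk : k < 2 * C.size + 1) :
    (kwL C v).2 ⟨k, hk⟩ = ((kwRow C k).1 v, (kwRow C k).2 v) := rfl

/-- Row `2m` is the even pair of gate `m`. [folklore] -/
theorem kwRow_even (m : ℕ) (hm : m < C.size) : kwRow C (2 * m) = gateRow C ⟨m, hm⟩ false := by
  unfold kwRow
  rw [dif_pos (show 2 * m / 2 < C.size by omega)]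
  congr 1
  · exact Fin.ext (show 2 * m / 2 = m by omega)
  · exact decide_eq_false (by omega)

/-- Row `2m + 1` is the odd pair of gate `m`. [folklore] -/
theorem kwRow_odd (m : ℕ) (hm : m < C.size) : kwRow C (2 * m + 1) = gateRow C ⟨m, hm⟩ true := by
  unfold kwRow
  rw [dif_pos (show (2 * m + 1) / 2 < C.size by omega)]
  congr 1
  · exact Fin.ext (show (2 * m + 1) / 2 = m by omega)
  · exact decide_eq_true (by omega)

/-- Row `2s` is the output pair. [folklore] -/
theorem kwRow_out : kwRow C (2 * C.size) = outRow C := by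
  unfold kwRow
  rw [dif_neg (show ¬ 2 * C.size / 2 < C.size by omega)]

/-- The gate equations for `ŷ` characterise the true transcript (adapted from the `hiff` step of
`CircuitArith.eval_validPoly`). [folklore] -/
theorem gateEqs_iff_transcript (z : Fin n → Bool) (y : Fin C.size → Bool) :
    (∀ m : Fin C.size, y m = (C.gates[m.val]'m.isLt).op fun a => bwval z y ((C.gates[m.val]'m.isLt).args a)) ↔
      List.ofFn y = transcript z [] C.gates := by
  -- adapted from Literature.Computability.AlgebraicComplexity.CircuitArith.eval_validPoly
  have hgv : ∀ m : Fin C.size,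
      ((C.gates[m.val]'m.isLt).op fun a => bwval z y ((C.gates[m.val]'m.isLt).args a)) =
        gateValue z (List.ofFn y) (C.gates[m.val]'m.isLt) := fun m => by
    unfold gateValue; congr 1; funext a; exact bwval_eq_wireVal z y _
  simp only [hgv]
  constructor
  · intro h
    refine eq_transcript_of_gate_equations C z (List.ofFn y) List.length_ofFn fun j hj => ?_
    have hj' : j < C.size := hj
    rw [List.getD_eq_getElem _ _ (by simpa using hj'), List.getElem_ofFn]
    exact h ⟨j, hj'⟩
  · intro h m
    have := getD_transcript_eq_gateValue C z m.val m.isLt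
    rw [← h, List.getD_eq_getElem _ _ (by simp), List.getElem_ofFn] at this
    exact this

/-- **Semantics of `kwL` at Boolean points**: all `2s + 1` pairs of `L(ẑ, 1, ŷ)` are nonzero iff
`ŷ` satisfies every gate equation and the output wire carries `0`. [folklore] -/
theorem kwL_bv_iff (hB : C.IsOver B2) (z : Fin n → Bool) (y : Fin C.size → Bool) :
    (∀ j : Fin (2 * C.size + 1), (kwL C (bv z y)).2 j ≠ 0) ↔
      (∀ m : Fin C.size, y m = (C.gates[m.val]'m.isLt).op fun a => bwval z y ((C.gates[m.val]'m.isLt).args a)) ∧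
        bwval z y C.output = false := by
  constructor
  · intro h
    refine ⟨fun m => ?_, ?_⟩
    · have hm := m.isLt
      have h0 := h ⟨2 * m.val, by omega⟩
      have h1 := h ⟨2 * m.val + 1, by omega⟩
      rw [kwL_snd_mk, kwRow_even C m.val hm] at h0
      rw [kwL_snd_mk, kwRow_odd C m.val hm] at h1
      exact (gatePairs_iff _ (hB _ (List.getElem_mem _)) z y ⟨m.val, hm⟩).1 ⟨h0, h1⟩
    · have h2 := h ⟨2 * C.size, by omega⟩
      rw [kwL_snd_mk, kwRow_out] at h2
      exact (outPair_iff z y C.output).1 h2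
  · rintro ⟨hg, hout⟩ ⟨j, hjlt⟩
    obtain ⟨m, rfl | rfl⟩ := Nat.even_or_odd' j
    · by_cases hm : m < C.size
      · rw [kwL_snd_mk, kwRow_even C m hm]
        exact ((gatePairs_iff _ (hB _ (List.getElem_mem _)) z y ⟨m, hm⟩).2 (hg ⟨m, hm⟩)).1
      · obtain rfl : m = C.size := by omega
        rw [kwL_snd_mk, kwRow_out]
        exact (outPair_iff z y C.output).2 hout
    · have hm : m < C.size := by omega
      rw [kwL_snd_mk, kwRow_odd C m hm]
      exact ((gatePairs_iff _ (hB _ (List.getElem_mem _)) z y ⟨m, hm⟩).2 (hg ⟨m, hm⟩)).2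

/-- **`C(z) = 0` iff some witness makes `σ(L(ẑ, w))` true.** (`⇒`: the true transcript with
`ε = 1`; `⇐`: `ε = 1` is forced, every `w` with `ε = 1` is a Boolean point, and the pairs force
the transcript and the output value.) [folklore] -/
theorem eval_eq_false_iff_exists (hB : C.IsOver B2) (z : Fin n → Bool) :
    C.eval z = false ↔ ∃ w : ZMod 2 × (Fin C.size → ZMod 2),
      (kwL C (boolOfZMod2 z, w)).1 = 1 ∧ ∀ j : Fin (2 * C.size + 1), (kwL C (boolOfZMod2 z, w)).2 j ≠ 0 := by
  constructor
  · intro hz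
    have hlen : (transcript z [] C.gates).length = C.size := by
      rw [length_transcript, List.length_nil, Nat.zero_add]; rfl
    let y : Fin C.size → Bool := fun j => (transcript z [] C.gates)[j.val]'(by rw [hlen]; exact j.isLt)
    have hy : List.ofFn y = transcript z [] C.gates := by
      apply List.ext_getElem (by rw [List.length_ofFn, hlen])
      intro i h1 h2
      rw [List.getElem_ofFn]
    refine ⟨(1, fun j => toK (ZMod 2) (y j)), rfl, ?_⟩
    refine (kwL_bv_iff C hB z y).2 ⟨(gateEqs_iff_transcript C z y).2 hy, ?_⟩
    rw [bwval_eq_wireVal, hy, ← eval_eq_wireVal, hz]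
  · rintro ⟨w, h1, h2⟩
    have hw1 : w.1 = 1 := h1
    have hw : w = (1, fun j => toK (ZMod 2) (decide (w.2 j = 1))) :=
      Prod.ext hw1 (funext fun j => eq_toK_decide (w.2 j))
    rw [hw] at h2
    obtain ⟨hg, hout⟩ := (kwL_bv_iff C hB z fun j => decide (w.2 j = 1)).1 h2
    have hyW := (gateEqs_iff_transcript C z _).1 hg
    rw [eval_eq_wireVal, ← hyW, ← bwval_eq_wireVal]
    exact hout

/-- **Stub `stub_kwTransfer` (Karchmer–Wigderson 1993, Thm. 7 with Thm. 1; deterministic case,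
per circuit).** The function computed by a `B₂`-circuit `C` on `n` inputs affords a linear
representation of dimension `2t + 1` with `t = 2 · C.size + 1`: there are a `GF(2)`-linear map
`P : GF(2)ⁿ → GF(2) × (GF(2)²)ᵗ` and a subspace `Q` with
`C(z) = 0 ⟺ ∃ q ∈ Q, (P ẑ + q).1 = 1 ∧ ∀ j, (P ẑ + q).2 j ≠ (0, 0)`; here `P = L ∘ inl` and
`Q = range (L ∘ inr)` for the linear map `kwL C` (two pairs per gate encoding the gate equation
`α = p·q + r` over `GF(2)`, one pair encoding "output wire `= 0`").
[cite: KarchmerWigderson1993, Thm. 7 and Thm. 1] -/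
theorem stub_kwTransfer :
    ∀ (n : ℕ) (C : Circuit (Fin n)), C.IsOver B2 →
      ∃ (P : (Fin n → ZMod 2) →ₗ[ZMod 2] (ZMod 2 × (Fin (2 * C.size + 1) → ZMod 2 × ZMod 2)))
        (Q : Submodule (ZMod 2) (ZMod 2 × (Fin (2 * C.size + 1) → ZMod 2 × ZMod 2))),
        ∀ z : Fin n → Bool, C.eval z = false ↔
          ∃ q ∈ Q, (P (boolOfZMod2 z) + q).1 = 1 ∧
            ∀ j : Fin (2 * C.size + 1), (P (boolOfZMod2 z) + q).2 j ≠ 0 := by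
  intro n C hB
  refine ⟨kwL C ∘ₗ LinearMap.inl (ZMod 2) _ _, LinearMap.range (kwL C ∘ₗ LinearMap.inr (ZMod 2) _ _),
    fun z => ?_⟩
  rw [eval_eq_false_iff_exists C hB z]
  have key : ∀ w : ZMod 2 × (Fin C.size → ZMod 2),
      (kwL C ∘ₗ LinearMap.inl (ZMod 2) _ _) (boolOfZMod2 z) + (kwL C ∘ₗ LinearMap.inr (ZMod 2) _ _) w =
        kwL C (boolOfZMod2 z, w) := fun w => by
    rw [LinearMap.comp_apply, LinearMap.comp_apply, ← map_add, LinearMap.inl_apply, LinearMap.inr_apply,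
      Prod.mk_add_mk, add_zero, zero_add]
  constructor
  · rintro ⟨w, hw⟩
    exact ⟨_, LinearMap.mem_range_self _ w, by rw [key]; exact hw⟩
  · rintro ⟨q, ⟨w, rfl⟩, hq⟩
    exact ⟨w, by rw [← key]; exact hq⟩

end Summit.PneNP.PneNP.Cruxes.CircuitSuperlinear.Sketch
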